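import Summits.AtomisticToContinuum.FouriersLaw.Theorems.BondHeatUncertaintyExtensiveSnapshotIrreversibilityOddCorrectorOfCorrectorGrade
import Summits.AtomisticToContinuum.FouriersLaw.Theorems.BondHeatUncertaintyExtensiveSnapshotIrreversibilityCorrectorCutIdentity
import Summits.AtomisticToContinuum.FouriersLaw.Theorems.BondHeatUncertaintySubdiffusiveBondHeatCurrentCorrectorGrading
import Summits.AtomisticToContinuum.FouriersLaw.Theorems.BondHeatUncertaintyBoundedResponseTransientContactBudget
import Summits.AtomisticToContinuum.FouriersLaw.Theorems.BondHeatUncertaintyBoundedResponseCorrectorCollapse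
import Summits.AtomisticToContinuum.FouriersLaw.Theorems.OddSectorIrreversibilityOddResponseBoundIntensive
import Summits.AtomisticToContinuum.FouriersLaw.Theorems.BoundaryKubo.Negative.Reflection
import HarnessLib

/-!
(SPLIT FOR THE 400-LINE CAP by the landing lane, hand-2 g37: this file = part 1 of 2 (§1 bookkeeping, §2 committor identity per bond, §3 the Kubo corrector `u_N`); the sequel `…BoundedResponseCommittorCorner` (§4 summed identity + fixed-`N` estimates, §5 the ladder statements) imports it; the module docstring stays here (putting it in part 2 would exceed the cap); same namespace / section / variables, all FQNs unchanged.)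
# NODE 100 «CommittorCorner» (lens-1, g100): the corrector grade (C₁) sits on the current-corrector ladder —
`CorrectorGrade 1 ⟺ CurrentCorrectorBudget 3` modulo the static block-energy variance (W); hence
E1 `ConeScaleCorrector` ⟹ (C₁) mod (W)

RESIDUAL MODE, residual N_F (TREE.md §N_F). After GEN 99C/99L both open items of N_F hang on ONE `N`-uniform
quantitative statement, the corrector grade
(C₁) `CorrectorGrade 1 : ‖h₀‖²_{L²(μ_{N,T})} = O(N)`, `h₀ = ∫₀^∞ P_t(p₀² − T) dt`
(11071 ⟸ (D_F) ∧ (C₁) by `boundedResponse_of_leakPoint_correctorGrade_one`; 9121 ⟸ S1r′ ∧ (C₁) by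
`lateOddResponse_of_correctorGrade_one`). Critic row 1407 asked lens-1 to make (C₁) ATTACKABLE — "an instrument
interface a sampler can decide, or a typed conditional with must-fails". This node does both at once by PLACING (C₁) ON AN
EXISTING, ALREADY-INSTRUMENTED LADDER: the current-corrector budgets `CurrentCorrectorBudget a` of
`…SubdiffusiveBondHeatCurrentCorrectorGrading` (57c: `∫ u² e^{−H/T}dx ≤ C·N^a·Z` for every a.e.-limit `u` of the
finite-horizon Kubo integrals of the TOTAL current `𝒥 = Σ_i j_i`; `a = 2` is the sibling route's staffed rank-2 crux
E1 = `ConeScaleCorrector` (stmt-14069), `a = 1` is (B_F)+, and `a ↦ CCB(a)` is monotone).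

## Thesis (all proved here, 0 sorry)

* `correctorGrade_one_of_currentCorrectorBudget_three : ExtensiveBlockEnergyVariance → CurrentCorrectorBudget 3 →
  CorrectorGrade 1` and its converse `currentCorrectorBudget_three_of_correctorGrade_one`, packaged as
  `correctorGrade_one_iff_currentCorrectorBudget_three : ExtensiveBlockEnergyVariance →
  (CorrectorGrade 1 ↔ CurrentCorrectorBudget 3)`.
* ★ `correctorGrade_one_of_coneScaleCorrector : ExtensiveBlockEnergyVariance → ConeScaleCorrector → CorrectorGrade 1`
  (E1 ⟹ CCB(2) ⟹ CCB(3) ⟹ (C₁)): the common leg (C₁) of BOTH residual items is DOMINATED by the sibling route's live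
  crux E1 plus one static estimate. Corollaries `kineticCorrectorBudget_of_coneScaleCorrector` (stmt-33857 ⟸ E1 ∧ (W))
  and `boundedResponse_of_leakPoint_coneScaleCorrector : (W) → LeakPoint → ConeScaleCorrector → BoundedResponse`
  (11071 ⟸ (D_F) ∧ E1 ∧ (W)).

## The mechanism: the committor corner identity

For every genuine bond `i` (`i + 1 < N`) the tree's cut identity
(`ClausiusBudget.two_mul_sq_mul_corrector_add_two_mul_kubo`, pointwise) and the pair identity
`h₀ + h_{N−1} = (H − ⟨H⟩)/γ` (`kinCorrector_pair_ae_eq`, a.e.) combine to the COMMITTOR IDENTITY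
`E_{≤i} − ⟨E_{≤i}⟩ = γ·h₀ + u_i` `μ_T`-a.e. (`leftEnergy_sub_mean_ae_eq`; `u_i = ∫₀^∞ P_s j_i ds`): the left heat
`Q_L = γh₀` is what the left bath must still extract, i.e. the block energy excess minus what crosses bond `i`.
Summing over the `N − 1` bonds (`kinCorrector_committor_ae_eq`):

  `γ(N−1)·h₀ = Σ_{i<N−1} (E_{≤i} − ⟨E_{≤i}⟩) − u_N`,  `u_N = Σ_i u_i = ∫₀^∞ P_s 𝒥 ds`.

This is the discrete gambler's-ruin profile of the committor against the block energies; squaring it trades `h₀`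
(ONE site, grade 1) against `u_N` (the TOTAL current, grade 3) at the cost of the static block variances only:
`γ²(N−1)²‖h₀‖² ≤ 2(N−1)·Σ_i Var(E_{≤i}) + 2‖u_N‖²` and `‖u_N‖² ≤ 2(N−1)Σ_i Var(E_{≤i}) + 2γ²(N−1)²‖h₀‖²`
(`sq_kinCorrector_le_of_blockVariance_of_totalKubo`, `sq_totalKubo_le_of_blockVariance_of_kinCorrector`, fixed `N`).
With `Var(E_{≤i}) ≤ C_W·N` ((W), uniformly in the cut) both error terms are `O(N³)`, which is exactly the exchange rate
`‖h₀‖² = O(N) ⟺ ‖u_N‖² = O(N³)`.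

## Pieces and tags (memo NODE-g100.md)

* (W) `ExtensiveBlockEnergyVariance` (g91, tree def; `Var_{μ_T}(E_{≤b}), Var_{μ_T}(E_{>b}) ≤ C·N` uniformly in the
  cut) — WEAKER · STATIC (equilibrium Gibbs measure only, no dynamics) · ATTACKABLE · M: Brascamp–Lieb for the uniformly
  convex position marginal + i.i.d. Gaussian momenta, the replay of 95V `energyFluctuationExtensive_holds` ((V), tree)
  for a block instead of the whole chain (`Var E_{>b} ≤ 2Var H + 2Var E_{≤b}` reduces the right block to (V) + left).
* CCB(3) `CurrentCorrectorBudget 3` — UNDECIDED · phonon-TRUE (equivalent mod (W) to (C₁), which phonons satisfy with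
  `‖h₀‖² ≤ T²N/(2γ²)`, 99C) · EQUIVALENT to (C₁) mod (W) (so NOT a costume: it is (C₁) read on the instrumented side) ·
  INSTRUMENTABLE: the E1 census sampler (equilibrium trajectories, finite-horizon Kubo integral of the total current,
  `L²(μ_T)`-norm vs `N`) decides the exponent; exponent `≤ 3` is (C₁), exponent `≤ 2` is E1.
* E1 `ConeScaleCorrector` (stmt-14069, staffed, rank 2 of the sibling route; phonon-FALSE) — STRONGER than needed:
  E1 ⟹ (C₁) mod (W). Consequence for the map: every census / proof effort on E1 pays into BOTH residual items of N_F;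
  conversely a refutation of (C₁) (super-ballistic corrector) refutes E1.

## Must-fails (probes/CHECKS-g100.md)

`CurrentCorrectorBudget 3 → CorrectorGrade 1` and `ExtensiveBlockEnergyVariance → CorrectorGrade 1` do not close by
`assumption | simp_all | aesop` (run); neither hypothesis alone is known to give (C₁): CCB(3) without (W) lacks the
static comparison of `u_N` with `h₀`, (W) without CCB(3) is an equilibrium statement with no dynamical content.

## Why novel (relative to the tree)

No tree file related the kinetic corrector `h₀` / `CorrectorGrade` / `KineticCorrectorBudget` (11071's line) to the
total-current corrector ladder `CurrentCorrectorBudget` (9121's sibling line E1): 99L proved (C₁) ⟹ S3w′ (odd corrector,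
one direction, exponent bookkeeping), 57c proved E1 ⟹ CCB(2) ⟹ (B_F)+. The committor identity summed over the cut is the
missing two-sided exchange `‖h₀‖² = O(N) ⟺ ‖u_N‖² = O(N³)` and puts the last `N`-uniform unknown of N_F UNDER an
already-staffed crux. References: the cut/committor bookkeeping is [BLR2000, §3] (left/right energies), the corrector
`u_N` and its `N³` normalisation [CEHR2018, Thm 2.13 discussion], Kubo correctors [McLennan1959]; all [folklore] here.

Imports tree files only; no `def`, no instance, no notation; one `section CommittorCorner` inside the existing
namespace `…Theorems.BoundedResponse.ParityFloor` (home of `CorrectorGrade`, `kinCorrector`, `LeakPoint`).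
-/

noncomputable section

open MeasureTheory ProbabilityTheory Filter Topology Set
open scoped ENNReal NNReal
open Literature.MathematicalPhysics.KineticTheory.HeatConduction
open Literature.MathematicalPhysics.KineticTheory
open Literature.MathematicalPhysics.KineticTheory.HeatConduction.HardTether (leftEnergy blockWeight bondWeight)
open Summit.AtomisticToContinuum.FouriersLaw.Theorems.SubdiffusiveBondHeat.EscapeGrading
  (CurrentCorrectorBudget currentCorrectorBudget_mono currentCorrectorBudget_two_of_coneScaleCorrector)
open Summit.AtomisticToContinuum.FouriersLaw.Theorems.BoundedResponse.TransientContact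
  (ExtensiveBlockEnergyVariance blockEnergyLeft blockEnergyLeftVar)
open Summit.AtomisticToContinuum.FouriersLaw.Theses.OddSectorIrreversibility (ConeScaleCorrector)
open Summit.AtomisticToContinuum.FouriersLaw.Theses.BondHeatUncertainty (BoundedResponse)
open Summit.AtomisticToContinuum.FouriersLaw.Theorems.SubdiffusiveBondHeat
  (pinnedChain_integrable_exp_mul_hamiltonian_transitionKernel)
open Summit.AtomisticToContinuum.FouriersLaw.Theorems.SubdiffusiveBondHeat.CorrectorBudget (KineticCorrectorBudget)
open Summit.AtomisticToContinuum.FouriersLaw.Theorems.BoundaryKubo.Negative.Reflection (bondCurrent_eq_zero_of_not_lt)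

namespace Summit.AtomisticToContinuum.FouriersLaw.Theorems.BoundedResponse.ParityFloor

variable {ω₂ lam β γ T : ℝ} {N : ℕ}

section CommittorCorner

/-! ## §1 Bookkeeping: the two block energies agree; the bond count -/

/-- The cell's `blockEnergyLeft P N b` (g91, indexed by `b : ℕ`) IS BLR's `HardTether.leftEnergy P N ⟨b, _⟩`
(both put half of the boundary bond `(b, b+1)` into the block). [formal bookkeeping] -/
theorem blockEnergyLeft_eq_leftEnergy (P : OscillatorChain) (b : Fin N) :
    blockEnergyLeft P N b.val = leftEnergy P N b := by
  funext x
  unfold blockEnergyLeft HardTether.leftEnergy HardTether.blockWeight HardTether.bondWeight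
  congr 1
  · refine Finset.sum_congr rfl fun k _ => ?_
    split_ifs <;> ring
  · refine Finset.sum_congr rfl fun k _ => Finset.sum_congr rfl fun l _ => ?_
    split_ifs <;> first | rfl | (exfalso; omega) | ring

/-- There are `N − 1` genuine bonds. [formal bookkeeping] -/
theorem card_filter_bond (hN : 0 < N) :
    (Finset.univ.filter (fun i : Fin N => i.val + 1 < N)).card = N - 1 := by
  have h : Finset.univ.filter (fun i : Fin N => ¬ (i.val + 1 < N)) = {(⟨N - 1, by omega⟩ : Fin N)} := by
    ext i
    simp only [Finset.mem_filter, Finset.mem_univ, true_and, Finset.mem_singleton, Fin.ext_iff]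
    omega
  have h2 := Finset.card_filter_add_card_filter_not
    (s := (Finset.univ : Finset (Fin N))) (fun i : Fin N => i.val + 1 < N)
  rw [h, Finset.card_singleton, Finset.card_univ, Fintype.card_fin] at h2
  omega

/-! ## §2 The committor identity per bond: `E_{≤i} − ⟨E_{≤i}⟩ = γ·h₀ + u_i` a.e. -/

/-- **The committor identity, per bond.** For `N ≥ 2` and every genuine bond `i` (`i + 1 < N`), `μ_T`-a.e.
`E_{≤i} − ⟨E_{≤i}⟩_{μ_T} = γ·h₀ + u_i`, where `h₀ = kinCorrector 0` is the Kubo corrector of `p_0² − T` and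
`u_i = ∫_{(0,∞)} P_s j_i ds` that of the bond current. It is the tree's even cut identity
(`ClausiusBudget.two_mul_sq_mul_corrector_add_two_mul_kubo`: `2T²w + 2u_i = (⟨H⟩ − H) − 2(⟨E_{≤i}⟩ − E_{≤i})`
pointwise, `w = (γ/2T²)(h₀ − h_{N−1})`) plus the energy coboundary `h₀ + h_{N−1} = (H − ⟨H⟩)/γ` a.e.
(`kinCorrector_pair_ae_eq`). In words: `γh₀ = Q_L` is the left-heat committor and `E_{≤i}` its static profile.
[cite: BonettoLebowitzReyBellet2000, §5.2] [folklore] -/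
theorem leftEnergy_sub_mean_ae_eq (hω : 0 < ω₂) (hl : 0 < lam) (hβ : 0 < β) (hγ : 0 < γ) (hT : 0 < T)
    (hN : 2 ≤ N) :
    ∀ᵐ z ∂((pinnedChain ω₂ lam β γ).gibbsMeasure N T), ∀ i : Fin N, i.val + 1 < N →
      leftEnergy (pinnedChain ω₂ lam β γ) N i z -
          ∫ x, leftEnergy (pinnedChain ω₂ lam β γ) N i x ∂((pinnedChain ω₂ lam β γ).gibbsMeasure N T) =
        γ * kinCorrector ω₂ lam β γ T N ⟨0, by omega⟩ z +
          ∫ s in Ioi (0 : ℝ), ∫ y, (pinnedChain ω₂ lam β γ).bondCurrent N i y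
            ∂((pinnedChain ω₂ lam β γ).transitionKernel N T T s.toNNReal z) := by
  have hN0 : 0 < N := by omega
  obtain ⟨hϑ0, -, hϑ1⟩ := weight_facts hT
  obtain ⟨K, c, hK, hc, hb⟩ := harrisBound_exists hω hl.le hβ hγ hN0 hT hϑ0 hϑ1
  -- (MIX) in the cut identity's format (`C := 1` in the Harris package)
  have hMIX : ∀ ϑ : ℝ, 0 < ϑ → ϑ < 1 / T → ∃ C c : ℝ, 0 < C ∧ 0 < c ∧
      ∀ (z : PhaseSpace N) (t : ℝ≥0) (f : PhaseSpace N → ℝ), Continuous f →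
        (∀ y, |f y| ≤ Real.exp (ϑ * (pinnedChain ω₂ lam β γ).hamiltonian N y)) →
        |(∫ y, f y ∂((pinnedChain ω₂ lam β γ).transitionKernel N T T t z)) -
            ∫ y, f y ∂((pinnedChain ω₂ lam β γ).gibbsMeasure N T)| ≤
          C * Real.exp (ϑ * (pinnedChain ω₂ lam β γ).hamiltonian N z) * Real.exp (-c * t) := by
    intro ϑ hϑ hϑT
    obtain ⟨K', c', hK', hc', hb'⟩ := harrisBound_exists hω hl.le hβ hγ hN0 hT hϑ hϑT
    refine ⟨K', c', hK', hc', fun z t f hf hf1 => ?_⟩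
    have h := hb' z t f hf 1 zero_le_one (fun y => by rw [one_mul]; exact hf1 y)
    rw [mul_one] at h
    exact h
  -- the McLennan corrector is `a(h₀ − h_{N−1})` pointwise, `a = γ/(2T²)`
  have hObs : ∀ (b : Fin N) (s : ℝ) (z : PhaseSpace N),
      Integrable (kinObs T N b) ((pinnedChain ω₂ lam β γ).transitionKernel N T T s.toNNReal z) := by
    intro b s z
    have hE := pinnedChain_integrable_exp_mul_hamiltonian_transitionKernel hω hl.le hT hβ.le hγ.le hN0 hϑ0 hϑ1
      s.toNNReal z
    refine (hE.const_mul (2 / (1 / (4 * T)) + T)).mono' (continuous_kinObs T b).aestronglyMeasurable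
      (Eventually.of_forall fun y => ?_)
    rw [Real.norm_eq_abs]
    exact abs_kinObs_le hω hl.le hβ.le hT.le hϑ0 b y
  have hw : ∀ z : PhaseSpace N,
      (∫ s in Ioi (0 : ℝ), ∫ y, γ / (2 * T ^ 2) *
          (y.2 ⟨0, hN0⟩ ^ 2 - y.2 ⟨N - 1, Nat.sub_lt hN0 one_pos⟩ ^ 2)
        ∂((pinnedChain ω₂ lam β γ).transitionKernel N T T s.toNNReal z)) =
      γ / (2 * T ^ 2) * (kinCorrector ω₂ lam β γ T N ⟨0, hN0⟩ z -
        kinCorrector ω₂ lam β γ T N ⟨N - 1, Nat.sub_lt hN0 one_pos⟩ z) := by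
    intro z
    have hin : ∀ s : ℝ, (∫ y, γ / (2 * T ^ 2) *
          (y.2 ⟨0, hN0⟩ ^ 2 - y.2 ⟨N - 1, Nat.sub_lt hN0 one_pos⟩ ^ 2)
        ∂((pinnedChain ω₂ lam β γ).transitionKernel N T T s.toNNReal z)) =
        γ / (2 * T ^ 2) * (kinAct ω₂ lam β γ T N ⟨0, hN0⟩ s z -
          kinAct ω₂ lam β γ T N ⟨N - 1, Nat.sub_lt hN0 one_pos⟩ s z) := by
      intro s
      have hfun : (fun y : PhaseSpace N => γ / (2 * T ^ 2) *
            (y.2 ⟨0, hN0⟩ ^ 2 - y.2 ⟨N - 1, Nat.sub_lt hN0 one_pos⟩ ^ 2)) =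
          fun y => γ / (2 * T ^ 2) * (kinObs T N ⟨0, hN0⟩ y - kinObs T N ⟨N - 1, Nat.sub_lt hN0 one_pos⟩ y) := by
        funext y; simp only [kinObs]; ring
      rw [hfun, integral_const_mul, integral_sub (hObs _ s z) (hObs _ s z)]
      rfl
    simp only [hin]
    rw [integral_const_mul, integral_sub (kinAct_integrableOn hω hl.le hβ hγ hT hϑ0 hb hc _ z).1
      (kinAct_integrableOn hω hl.le hβ hγ hT hϑ0 hb hc _ z).1]
    rfl
  have hpair := kinCorrector_pair_ae_eq hω hl.le hβ hγ hN hT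
  filter_upwards [hpair] with z hz
  intro i hi
  have hcut := ExtensiveSnapshotIrreversibility.ClausiusBudget.two_mul_sq_mul_corrector_add_two_mul_kubo
    hω hl hβ hγ hT hN0 hMIX i hi z
  rw [hw z] at hcut
  -- abbreviations
  set h0 := kinCorrector ω₂ lam β γ T N ⟨0, hN0⟩ z with hh0
  set h1 := kinCorrector ω₂ lam β γ T N ⟨N - 1, Nat.sub_lt hN0 one_pos⟩ z with hh1
  set Hz := (pinnedChain ω₂ lam β γ).hamiltonian N z with hHz
  set mH := ∫ x, (pinnedChain ω₂ lam β γ).hamiltonian N x ∂((pinnedChain ω₂ lam β γ).gibbsMeasure N T)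
    with hmH
  have hz' : h0 + h1 = (Hz - mH) / γ := hz
  have hγh1 : γ * h1 = (Hz - mH) - γ * h0 := by
    have h := hz'
    field_simp at h
    linarith
  have e1 : 2 * T ^ 2 * (γ / (2 * T ^ 2) * (h0 - h1)) = γ * h0 - γ * h1 := by
    field_simp
  rw [e1] at hcut
  linear_combination (-(1 / 2) : ℝ) * hcut + (-(1 / 2) : ℝ) * hγh1

/-! ## §3 The Kubo corrector `u_N` of the TOTAL current: square-integrability, bond sum, finite horizons -/

/-- `|j_i| ≤ M_N(ϑ)·e^{ϑH}` with `M_N(ϑ) = N(3+β)/2 · 2e^{ϑ}/ϑ²`. [folklore] -/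
theorem abs_bondCurrent_le_constMulExp (hω : 0 ≤ ω₂) (hl : 0 ≤ lam) (hβ : 0 ≤ β) (γ : ℝ) {ϑ : ℝ} (hϑ : 0 < ϑ)
    (i : Fin N) (y : PhaseSpace N) :
    |(pinnedChain ω₂ lam β γ).bondCurrent N i y| ≤
      (N * ((3 + β) / 2) * (2 * Real.exp ϑ / ϑ ^ 2)) *
        Real.exp (ϑ * (pinnedChain ω₂ lam β γ).hamiltonian N y) := by
  have hH0 := pinnedChain_hamiltonian_nonneg hω hl hβ γ N y
  have hj := pinnedChain_abs_bondCurrent_le hω hl hβ γ N i y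
  have hsq := one_add_sq_le_exp hH0 hϑ
  calc |(pinnedChain ω₂ lam β γ).bondCurrent N i y|
      ≤ N * ((3 + β) / 2 * (1 + (pinnedChain ω₂ lam β γ).hamiltonian N y) ^ 2) := hj
    _ = N * ((3 + β) / 2) * (1 + (pinnedChain ω₂ lam β γ).hamiltonian N y) ^ 2 := by ring
    _ ≤ N * ((3 + β) / 2) * (2 * Real.exp ϑ / ϑ ^ 2 *
          Real.exp (ϑ * (pinnedChain ω₂ lam β γ).hamiltonian N y)) :=
        mul_le_mul_of_nonneg_left hsq (by positivity)
    _ = _ := by ring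

/-- **Facts about `u_N = ∫_{(0,∞)} P_s 𝒥 ds`, `𝒥 = Σ_i j_i`** (`N ≥ 1`, equilibrium kernels at `T`): `u_N` is strongly
measurable with `u_N² ∈ L¹(μ_T)`; it is the SUM of the bond correctors `u_i` (pointwise); and the finite-horizon Kubo
integrals `∫_{(0,τ]} P_t 𝒥 dt` converge to it at EVERY point (so `u_N` is the `u` of `CurrentCorrectorBudget` /
`ConeScaleCorrector`). Harris package at `ϑ = 1/(4T)`. [cite: CuneoEckmannHairerReyBellet2018, Thm 2.13] [folklore] -/
theorem totalKubo_facts (hω : 0 < ω₂) (hl : 0 < lam) (hβ : 0 < β) (hγ : 0 < γ) (hT : 0 < T) (hN : 0 < N) :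
    StronglyMeasurable (fun z : PhaseSpace N => ∫ s in Ioi (0 : ℝ), ∫ y,
        (∑ i : Fin N, (pinnedChain ω₂ lam β γ).bondCurrent N i y)
          ∂((pinnedChain ω₂ lam β γ).transitionKernel N T T s.toNNReal z)) ∧
    Integrable (fun z : PhaseSpace N => (∫ s in Ioi (0 : ℝ), ∫ y,
        (∑ i : Fin N, (pinnedChain ω₂ lam β γ).bondCurrent N i y)
          ∂((pinnedChain ω₂ lam β γ).transitionKernel N T T s.toNNReal z)) ^ 2)
      ((pinnedChain ω₂ lam β γ).gibbsMeasure N T) ∧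
    (∀ z : PhaseSpace N, (∫ s in Ioi (0 : ℝ), ∫ y,
        (∑ i : Fin N, (pinnedChain ω₂ lam β γ).bondCurrent N i y)
          ∂((pinnedChain ω₂ lam β γ).transitionKernel N T T s.toNNReal z)) =
      ∑ i : Fin N, ∫ s in Ioi (0 : ℝ), ∫ y, (pinnedChain ω₂ lam β γ).bondCurrent N i y
          ∂((pinnedChain ω₂ lam β γ).transitionKernel N T T s.toNNReal z)) ∧
    (∀ z : PhaseSpace N, Tendsto (fun τ : ℝ => ∫ t in Ioc (0 : ℝ) τ,
        (∫ y, (∑ i : Fin N, (pinnedChain ω₂ lam β γ).bondCurrent N i y)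
          ∂((pinnedChain ω₂ lam β γ).transitionKernel N T T t.toNNReal z))) atTop
      (𝓝 (∫ s in Ioi (0 : ℝ), ∫ y,
        (∑ i : Fin N, (pinnedChain ω₂ lam β γ).bondCurrent N i y)
          ∂((pinnedChain ω₂ lam β γ).transitionKernel N T T s.toNNReal z)))) := by
  set P := pinnedChain ω₂ lam β γ with hP
  obtain ⟨hϑ0, h2ϑ, hϑ1⟩ := weight_facts hT
  obtain ⟨K, c, hK, hc, hb⟩ := harrisBound_exists hω hl.le hβ hγ hN hT hϑ0 hϑ1
  set ϑ : ℝ := 1 / (4 * T) with hϑ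
  set M : ℝ := N * ((3 + β) / 2) * (2 * Real.exp ϑ / ϑ ^ 2) with hM
  have hM0 : 0 ≤ M := by positivity
  set J : PhaseSpace N → ℝ := fun y => ∑ i : Fin N, P.bondCurrent N i y with hJ
  -- statics of the single currents and of `𝒥`
  have hjc : ∀ i : Fin N, Continuous (P.bondCurrent N i) := fun i => pinnedChain_continuous_bondCurrent ω₂ lam β γ N i
  have hjb : ∀ (i : Fin N) (y : PhaseSpace N), |P.bondCurrent N i y| ≤ M * Real.exp (ϑ * P.hamiltonian N y) :=
    fun i y => abs_bondCurrent_le_constMulExp hω.le hl.le hβ.le γ hϑ0 i y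
  have hJc : Continuous J := continuous_finsetSum _ fun i _ => hjc i
  have hJb : ∀ y, |J y| ≤ (N * M) * Real.exp (ϑ * P.hamiltonian N y) := fun y => by
    calc |J y| ≤ ∑ i : Fin N, |P.bondCurrent N i y| := Finset.abs_sum_le_sum_abs _ _
      _ ≤ ∑ _i : Fin N, M * Real.exp (ϑ * P.hamiltonian N y) := Finset.sum_le_sum fun i _ => hjb i y
      _ = (N * M) * Real.exp (ϑ * P.hamiltonian N y) := by
          rw [Finset.sum_const, Finset.card_univ, Fintype.card_fin, nsmul_eq_mul]; ring
  have hNM0 : 0 ≤ (N : ℝ) * M := by positivity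
  have hjint : ∀ i : Fin N, Integrable (P.bondCurrent N i) (P.gibbsMeasure N T) := fun i =>
    ((pinnedChain_integrable_exp_mul_hamiltonian_gibbsMeasure hω hl.le hβ.le γ N hT hϑ1).const_mul M).mono'
      (hjc i).aestronglyMeasurable (Eventually.of_forall fun y => by rw [Real.norm_eq_abs]; exact hjb i y)
  have hJ0 : ∫ y, J y ∂(P.gibbsMeasure N T) = 0 := by
    show ∫ y, (∑ i : Fin N, P.bondCurrent N i y) ∂(P.gibbsMeasure N T) = 0
    rw [integral_finsetSum _ fun i _ => hjint i]
    exact Finset.sum_eq_zero fun i _ => pinnedChain_integral_bondCurrent_gibbsMeasure ω₂ lam β γ N T i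
  -- the Kubo toolkit for `𝒥`
  have hsm : StronglyMeasurable (fun z : PhaseSpace N => ∫ s in Ioi (0 : ℝ), ∫ y, J y
      ∂(P.transitionKernel N T T s.toNNReal z)) :=
    OddSectorIrreversibility.pinnedChain_stronglyMeasurable_kubo hω hl.le hβ.le hγ.le T T hJc.measurable
  have hub : ∀ z : PhaseSpace N, |∫ s in Ioi (0 : ℝ), ∫ y, J y ∂(P.transitionKernel N T T s.toNNReal z)| ≤
      K * (N * M) / c * Real.exp (ϑ * P.hamiltonian N z) := fun z =>
    (OddSectorIrreversibility.pinnedChain_abs_kubo_le hω hl.le hβ hγ hb hc hJc hNM0 hJb hJ0 z).trans_eq (by ring)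
  have hsq := (OddSectorIrreversibility.pinnedChain_integral_sq_act_le_of_stronglyMeasurable hω hl.le hβ hγ hN hT
    hϑ0 h2ϑ hsm hub 0).1
  have htend : ∀ z : PhaseSpace N, Tendsto (fun τ : ℝ => ∫ t in Ioc (0 : ℝ) τ,
      (∫ y, J y ∂(P.transitionKernel N T T t.toNNReal z))) atTop
      (𝓝 (∫ s in Ioi (0 : ℝ), ∫ y, J y ∂(P.transitionKernel N T T s.toNNReal z))) := fun z =>
    OddSectorIrreversibility.pinnedChain_tendsto_kubo hω hl.le hβ hγ hb hc hJc hNM0 hJb hJ0 z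
  -- the bond sum (linearity of the absolutely convergent Kubo integrals)
  have hkin : ∀ (i : Fin N) (s : ℝ) (z : PhaseSpace N),
      Integrable (P.bondCurrent N i) (P.transitionKernel N T T s.toNNReal z) := fun i s z =>
    ExtensiveSnapshotIrreversibility.ClausiusBudget.integrable_transitionKernel_of_le_exp hω hl hβ hγ hT hN
      hϑ0 hϑ1 (hjc i) (hjb i) s.toNNReal z
  have hkubo : ∀ (i : Fin N) (z : PhaseSpace N),
      IntegrableOn (fun s : ℝ => ∫ y, P.bondCurrent N i y ∂(P.transitionKernel N T T s.toNNReal z)) (Ioi 0) :=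
    fun i z => (OddSectorIrreversibility.pinnedChain_integrableOn_kubo hω hl.le hβ hγ hb hc (hjc i) hM0 (hjb i)
      (pinnedChain_integral_bondCurrent_gibbsMeasure ω₂ lam β γ N T i) z).1
  have hsum : ∀ z : PhaseSpace N, (∫ s in Ioi (0 : ℝ), ∫ y, J y ∂(P.transitionKernel N T T s.toNNReal z)) =
      ∑ i : Fin N, ∫ s in Ioi (0 : ℝ), ∫ y, P.bondCurrent N i y ∂(P.transitionKernel N T T s.toNNReal z) := by
    intro z
    have hfun : (fun s : ℝ => ∫ y, J y ∂(P.transitionKernel N T T s.toNNReal z)) =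
        fun s => ∑ i : Fin N, ∫ y, P.bondCurrent N i y ∂(P.transitionKernel N T T s.toNNReal z) :=
      funext fun s => integral_finsetSum _ fun i _ => hkin i s z
    rw [hfun, integral_finsetSum _ fun i _ => hkubo i z]
  exact ⟨hsm, hsq, hsum, htend⟩

end CommittorCorner

end Summit.AtomisticToContinuum.FouriersLaw.Theorems.BoundedResponse.ParityFloor

end
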